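import Mathlib
import Summits.NavierStokesRegularity.NavierStokesRegularity.Theorems.TaoLadderRungThreeRestartGlue
import Summits.NavierStokesRegularity.NavierStokesRegularity.Theses.TrappingWindowRungThree
import Summits.NavierStokesRegularity.NavierStokesRegularity.Theses.ExactWindowRungThree
import HarnessLib

/-!
# `TrappingWindowRungThree.RestartGlue` = `ExactWindowRungThree.RestartGlue`
  (item stmt-NavierStokesRegularity-21751, wanted by both routes)

The support `RestartGlue` of routes `TrappingWindowRungThree` and `ExactWindowRungThree` is,
character for character, the shared support `RestartGlue` of routes `TaoLadderRungThree` /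
`TaoLadderRungTwo` / `TaoLadderRungTwoPoly` (items stmt-NavierStokesRegularity-20425 / 20651),
already proved in the tree as `Theorems.RestartGlue.epochCheckpoints_succ`
(file `TaoLadderRungThreeRestartGlue.lean`): a `StepTo` of the flow restarted at checkpoint
`(N, t_N, e_N)` is a level-`N+1` `EpochCheckpoints` of the original family with
`t_{N+1} = t_N + τ₁/γ`, `e_{N+1} = a · e_N`. This file closes the new item in BOTH route readings
by that theorem.

HONEST FRAMING: definitional bookkeeping about Tao-type MODEL lattice pseudo-flows (Tao 2016 §6);
nothing here is a statement about the Navier–Stokes equations, and the routes' rung leaf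
(`TaoLadderRungThree.Target`, TL-M3) is not the summit Statement.
-/

noncomputable section

set_option linter.dupNamespace false

namespace Summit.NavierStokesRegularity.NavierStokesRegularity.Theorems

open RestartGlue in
/-- **Item stmt-NavierStokesRegularity-21751** read in route `TrappingWindowRungThree`
(`TrappingWindowRungThree.RestartGlue`): a `StepTo` of the restarted flow is a level-`N+1`
`EpochCheckpoints` of the original family, closed by the tree theorem
`RestartGlue.epochCheckpoints_succ`. [cite: Tao2016AveragedNS, §6.4 with §6.2 Prop. 6.3 (vi)–(ix)] -/
theorem trappingWindowRungThree_restartGlue_proof :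
    Summit.NavierStokesRegularity.NavierStokesRegularity.Theses.TrappingWindowRungThree.RestartGlue := by
  unfold Summit.NavierStokesRegularity.NavierStokesRegularity.Theses.TrappingWindowRungThree.RestartGlue
  intro ε₀ θ c m i₀ n₀ X₀ P Q N X E t e τ₁ a hε₀ hN h hst
  exact epochCheckpoints_succ hε₀ hN h hst

open RestartGlue in
/-- **Item stmt-NavierStokesRegularity-21751** read in route `ExactWindowRungThree`
(`ExactWindowRungThree.RestartGlue`): the same statement, closed by the same tree theorem
`RestartGlue.epochCheckpoints_succ`. [cite: Tao2016AveragedNS, §6.4 with §6.2 Prop. 6.3 (vi)–(ix)] -/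
theorem exactWindowRungThree_restartGlue_proof :
    Summit.NavierStokesRegularity.NavierStokesRegularity.Theses.ExactWindowRungThree.RestartGlue := by
  unfold Summit.NavierStokesRegularity.NavierStokesRegularity.Theses.ExactWindowRungThree.RestartGlue
  intro ε₀ θ c m i₀ n₀ X₀ P Q N X E t e τ₁ a hε₀ hN h hst
  exact epochCheckpoints_succ hε₀ hN h hst

end Summit.NavierStokesRegularity.NavierStokesRegularity.Theorems

end
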